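import Summits.FinalStateConjecture.FinalStateConjecture.Theorems.PhotonSphereChannelsTameCensorshipLensDomain
import Literature.Geometry.Lorentzian.HypersurfaceShadowDomainCauchy
import HarnessLib

/-!
# Crux `TameCensorship` (stmt-FinalStateConjecture-10047), line `crush-the-swallowed-interior`,
# fact-stub F1 `stub_factFutureCauchyCrushBound` — III: the globally hyperbolic region of a
# future Cauchy hypersurface

Pure causality (continuing `…TameCensorshipLensCausality`, `…TameCensorshipLensDomain`). Setting:
`(M, g, τ)` Hausdorff, second countable, finite-dimensional, boundaryless model, `Cⁿ` metric,
`n ≥ 2`, with the endpoint properties `hE`, `hE'` of timelike curves (discharged for smooth metrics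
by `CausalCurveEndpoint.lean`); `S ⊆ M` closed, achronal, with a local Cauchy lens about each of
its points (`hL`) and **future Cauchy** (`hFC`, the hypothesis of the stub: every past-endless
causal curve through a point of `J⁺(S)` meets `S` earlier; O'Neill 1983, Ch. 14, Ex. 14.9). With
(defining equations `hT`, `hW`; no definition is made)
`T = {x | every z ∈ I⁺(x) ∩ I⁻(S) has (P)}`, (P)(z): every future timelike curve from `z` without
future endpoint in `M` meets `S`, and `W = I⁺(S) ∪ S ∪ (I⁺(T) ∩ I⁻(S))`:

* `lens_subset_domain`, `isOpen_domain`, `causalFuture_subset_domain` — every lens lies in `W`,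
  `W` is open, `J⁺(S) ⊆ W`;
* `isCauchyHypersurface_domain` — **`S` is a Cauchy hypersurface of every open `W' ⊆ W` which is
  relatively closed in `W`** (e.g. a connected component): an endless timelike curve of `W'`
  missing `S` lies in `I⁺(S)` or in `I⁺(T) ∩ I⁻(S)` (connectedness) and is excluded by
  `false_of_curve_in_domain_future` (`hFC`, endpoint `e ∉ W`, endless extension of a segment from
  `e`) resp. its dual `false_of_curve_in_domain_past` ((P) in place of `hFC`); uniqueness of the
  crossing is achronality.

This replaces, for a future Cauchy hypersurface, the passage through `int D(S)` of O'Neill 1983,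
Ch. 14, Lemma 14.43 / Thm. 14.38 (printed proofs by limit curves); Wald's Cauchy form of Hawking's
crush bound is applied to a component of `W` in step V. Everything is proved; no definitions, no
named facts.

## References

* B. O'Neill, *Semi-Riemannian geometry with applications to relativity*, Academic Press 1983,
  Ch. 14, Lemma 14.29, Thm. 14.38, Lemma 14.43, Ex. 14.9, Thm. 14.55A (pp. 415–432).
  [ONeillSemiRiemannian1983]
* S. W. Hawking, G. F. R. Ellis, *The large scale structure of space-time*, CUP 1973, §6.5–6.6,
  Prop. 6.6.3. [HawkingEllis1973CUP]
* R. M. Wald, *General Relativity*, Chicago 1984, Thm. 9.5.1. [Wald1984GR]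
-/
noncomputable section

-- The tree namespace `Summit.FinalStateConjecture.FinalStateConjecture.…` (summit = sub-problem)
-- repeats a component by design (D-0022), which the `dupNamespace` linter would flag on every decl.
set_option linter.dupNamespace false

open Bundle Set Filter Function Topology TopologicalSpace
open scoped Manifold ContDiff Topology

open Literature.Geometry.Lorentzian

namespace Summit.FinalStateConjecture.FinalStateConjecture.Theorems.PhotonSphereChannels.TameCensorshipCrush

variable {E : Type*} [NormedAddCommGroup E] [NormedSpace ℝ E] {H : Type*} [TopologicalSpace H]
  {I : ModelWithCorners ℝ E H} {n : ℕ∞ω} {M : Type*} [TopologicalSpace M] [ChartedSpace H M]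
  [IsManifold I ∞ M] [T2Space M] [SecondCountableTopology M] [I.Boundaryless]
  [FiniteDimensional ℝ E]

variable {g : LorentzianMetric I n M} {τ : TimeOrientation g}
  (hres : PseudoRiemannianMetric.contMDiff_restrict (I := I) (n := n) (M := M))
  (hτ : τ.contMDiff_restrict)

section Domain

variable {S T W : Set M}
  (hT : T = {x | ∀ z ∈ g.chronologicalFuture τ {x}, z ∈ g.chronologicalPast τ S →
    ∀ (δ : ℝ → M) (s : Set ℝ), s.OrdConnected → g.IsFutureTimelikeCurveOn τ δ s →
      IsFutureEndless δ s → ∀ t₀ ∈ s, δ t₀ = z → ∃ t ∈ s, t₀ ≤ t ∧ δ t ∈ S})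
  (hW : W = g.chronologicalFuture τ S ∪ S ∪ (g.chronologicalFuture τ T ∩ g.chronologicalPast τ S))

include hT in
/-- **Points of a lens below `S` are in `T`.** If `S` is achronal, `S ∩ V` is a Cauchy
hypersurface of the open sub-spacetime `V` and `x ∈ V ∩ I⁻(S)`, then `x ∈ T`: a point `z` with
`x ≪ z`, `z ∈ I⁻(S)` lies in `V` (`chronologicalFuture_inter_chronologicalPast_subset_lens`) and has
property (P) (`exists_mem_of_lens_of_mem_chronologicalPast`). [cite: ONeillSemiRiemannian1983, Ch. 14, Thm. 14.38 (pp. 421–423)] -/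
theorem mem_T_of_lens (hn : 2 ≤ n) (hA : g.IsAchronal τ S) {V : Opens M}
    (hV : (g.restrict hres V).IsCauchyHypersurface (τ.restrict hres hτ V) (Subtype.val ⁻¹' S))
    {x : M} (hxV : x ∈ V) (hx : x ∈ g.chronologicalPast τ S) : x ∈ T := by
  rw [hT]
  intro z hzx hzS δ s hs hδ hend t₀ ht₀ hδt₀
  have hzV : z ∈ (V : Set M) :=
    chronologicalFuture_inter_chronologicalPast_subset_lens hres hτ hn hA hV hxV hx ⟨hzx, hzS⟩
  exact exists_mem_of_lens_of_mem_chronologicalPast hres hτ hn hA hV hzV hzS hs hδ hend ht₀ hδt₀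

include hT hW in
/-- **Every lens of `S` lies in `W`.** A point of the lens `V` is on `S`, in `I⁺(S)`, or in
`I⁻(S)` (`mem_union_of_lens`); in the last case the endless timelike curve of `V` through it
provides a point `x ∈ V ∩ I⁻(S)` chronologically below it, and `x ∈ T` (`mem_T_of_lens`).
[cite: ONeillSemiRiemannian1983, Ch. 14, Thm. 14.38 (pp. 421–423)] -/
theorem lens_subset_domain (hn : 2 ≤ n) (hA : g.IsAchronal τ S) {V : Opens M}
    (hV : (g.restrict hres V).IsCauchyHypersurface (τ.restrict hres hτ V) (Subtype.val ⁻¹' S)) :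
    (V : Set M) ⊆ W := by
  intro w hw
  rw [hW]
  rcases mem_union_of_lens hres hτ hn hV hw with h | h | h
  · exact Or.inl (Or.inr h)
  · exact Or.inl (Or.inl h)
  · right
    refine ⟨?_, h⟩
    -- a point `x ≪ w` of `V`, along the endless timelike curve of `V` through `w`
    obtain ⟨Δ, D, hΔ, h0D, hΔ0⟩ :=
      LorentzianMetric.exists_isEndlessTimelikeCurve_through (g := g.restrict hres V)
        (τ := τ.restrict hres hτ V) hn (⟨w, hw⟩ : V)
    obtain ⟨t, htD, ht0⟩ : ∃ t ∈ D, t < 0 := by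
      by_contra hcon
      push Not at hcon
      exact hΔ.2.2.2.2 (Δ 0) (hasPastEndpoint_of_isLeast ⟨h0D, hcon⟩)
    have hc : g.IsFutureTimelikeCurveOn τ (Subtype.val ∘ Δ) D :=
      (LorentzianMetric.isFutureTimelikeCurveOn_restrict_iff g τ hres hτ V).1 hΔ.2.1
    have hw0 : (Subtype.val ∘ Δ) 0 = w := by
      show (Δ 0 : M) = w
      rw [hΔ0]
    have hwx : w ∈ g.chronologicalFuture τ {(Δ t : M)} :=
      ⟨(Δ t : M), rfl, Subtype.val ∘ Δ, t, 0, ht0, hc.mono (hΔ.1.out htD h0D), rfl, hw0⟩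
    have hxS : (Δ t : M) ∈ g.chronologicalPast τ S :=
      LorentzianMetric.mem_chronologicalFuture_trans (τ := τ.reverse) h
        (LorentzianMetric.mem_chronologicalPast_of_mem_chronologicalFuture hwx)
    have hxT : (Δ t : M) ∈ T := mem_T_of_lens hres hτ hT hn hA hV (Δ t).2 hxS
    exact LorentzianMetric.chronologicalFuture_mono (singleton_subset_iff.mpr hxT) hwx

include hT hW in
/-- **`W` is open** when every point of `S` has a lens: `I⁺(S)` and `I⁺(T) ∩ I⁻(S)` are open, and a
point of `S` has its (open) lens inside `W` (`lens_subset_domain`).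
[cite: ONeillSemiRiemannian1983, Ch. 14, Lemma 14.43 (pp. 425–426)] -/
theorem isOpen_domain (hn : 2 ≤ n) (hA : g.IsAchronal τ S)
    (hL : ∀ p ∈ S, ∃ V : Opens M, p ∈ V ∧
      (g.restrict hres V).IsCauchyHypersurface (τ.restrict hres hτ V) (Subtype.val ⁻¹' S)) :
    IsOpen W := by
  rw [isOpen_iff_mem_nhds]
  intro w hw
  have hw' := hw
  rw [hW] at hw'
  rcases hw' with (h | h) | h
  · refine mem_of_superset ((LorentzianMetric.isOpen_chronologicalFuture_of_boundaryless g τ S).mem_nhds h) ?_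
    rw [hW]
    exact fun x hx ↦ Or.inl (Or.inl hx)
  · obtain ⟨V, hwV, hV⟩ := hL w h
    exact mem_of_superset (V.isOpen.mem_nhds hwV) (lens_subset_domain hres hτ hT hW hn hA hV)
  · refine mem_of_superset (((LorentzianMetric.isOpen_chronologicalFuture_of_boundaryless g τ T).inter
      (LorentzianMetric.isOpen_chronologicalPast_of_boundaryless g τ S)).mem_nhds h) ?_
    rw [hW]
    exact fun x hx ↦ Or.inr hx

include hW in
/-- **`J⁺(S) ⊆ W`**: `J⁺(S) ⊆ S ∪ I⁺(S)` for a closed achronal set with lenses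
(`causalFuture_subset_of_lenses`). [cite: ONeillSemiRiemannian1983, Ch. 14, Lemma 14.42 (p. 425)] -/
theorem causalFuture_subset_domain (hn : 2 ≤ n) (hSc : IsClosed S) (hA : g.IsAchronal τ S)
    (hL : ∀ p ∈ S, ∃ V : Opens M, p ∈ V ∧
      (g.restrict hres V).IsCauchyHypersurface (τ.restrict hres hτ V) (Subtype.val ⁻¹' S)) :
    g.causalFuture τ S ⊆ W := by
  intro q hq
  rw [hW]
  rcases causalFuture_subset_of_lenses hres hτ hn hSc hA hL hq with h | h
  · exact Or.inl (Or.inr h)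
  · exact Or.inl (Or.inl h)

end Domain

/-! ### The Cauchy property of `S` in `W` -/

section Cauchy

variable {S T W : Set M}
  (hT : T = {x | ∀ z ∈ g.chronologicalFuture τ {x}, z ∈ g.chronologicalPast τ S →
    ∀ (δ : ℝ → M) (s : Set ℝ), s.OrdConnected → g.IsFutureTimelikeCurveOn τ δ s →
      IsFutureEndless δ s → ∀ t₀ ∈ s, δ t₀ = z → ∃ t ∈ s, t₀ ≤ t ∧ δ t ∈ S})
  (hW : W = g.chronologicalFuture τ S ∪ S ∪ (g.chronologicalFuture τ T ∩ g.chronologicalPast τ S))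
  (hE : ∀ {c : ℝ → M} {s : Set ℝ} {e : M} {t t' : ℝ}, s.OrdConnected →
    g.IsFutureTimelikeCurveOn τ c s → HasPastEndpoint c s e → t ∈ s → t' ∈ s → t < t' →
    c t' ∈ g.chronologicalFuture τ {e})
  (hE' : ∀ {c : ℝ → M} {s : Set ℝ} {e : M} {t t' : ℝ}, s.OrdConnected →
    g.IsFutureTimelikeCurveOn τ c s → HasFutureEndpoint c s e → t ∈ s → t' ∈ s → t < t' →
    c t ∈ g.chronologicalPast τ {e})
  (hFC : g.causalFuture τ S ⊆ {p | ∀ (β : ℝ → M) (s : Set ℝ), s.OrdConnected →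
    g.IsFutureCausalCurveOn τ β s → IsPastEndless β s → ∀ t₀ ∈ s, β t₀ = p →
    ∃ t ∈ s, t ≤ t₀ ∧ β t ∈ S})

include hW hE hFC in
/-- **Key lemma, future side.** A future timelike curve `c` on an interval `s`, with values in
`W` and all in `I⁺(S)`, missing `S`, whose past half from `t₀ ∈ s` has no past endpoint in `W`,
is impossible: either the past half has no past endpoint at all — then it meets `S` by `hFC` — or
its past endpoint `e ∉ W` is below `c t₀` (`hE`), and the endless extension of a segment from `e`
to `c t₀` meets `S` at or below `e` (`hFC`), putting `e` in `S ∪ I⁺(S) ⊆ W` or in the open set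
`I⁻(S)`, which would contain points of `c ⊆ I⁺(S)`.
[cite: ONeillSemiRiemannian1983, Ch. 14, Thm. 14.38 and Thm. 14.55A (pp. 421–432)] -/
theorem false_of_curve_in_domain_future (hn : 2 ≤ n) (hA : g.IsAchronal τ S) {c : ℝ → M}
    {s : Set ℝ} (hs : s.OrdConnected) (hc : g.IsFutureTimelikeCurveOn τ c s)
    (hcW : ∀ t ∈ s, c t ∈ W) (hmiss : ∀ t ∈ s, c t ∉ S) {t₀ : ℝ} (ht₀ : t₀ ∈ s)
    (hend : ∀ e ∈ W, ¬ HasPastEndpoint c (s ∩ Iic t₀) e)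
    (hall : ∀ t ∈ s, c t ∈ g.chronologicalFuture τ S) : False := by
  have hdisj : Disjoint (g.chronologicalFuture τ S) (g.chronologicalPast τ S) :=
    hA.disjoint_chronologicalFuture_chronologicalPast
  set J : Set ℝ := s ∩ Iic t₀ with hJ_def
  have hJ : J.OrdConnected := hs.inter ordConnected_Iic
  have ht₀J : t₀ ∈ J := ⟨ht₀, self_mem_Iic⟩
  have hJs : J ⊆ s := inter_subset_left
  have hcJ : g.IsFutureTimelikeCurveOn τ c J := hc.mono hJs
  have hp : c t₀ ∈ g.causalFuture τ S :=
    LorentzianMetric.chronologicalFuture_subset_causalFuture g τ S (hall t₀ ht₀)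
  by_cases hendJ : IsPastEndless c J
  · -- no past endpoint: the future Cauchy property applies to the past half itself
    obtain ⟨t, htJ, -, htS⟩ := hFC hp c J hJ hcJ.isFutureCausalCurveOn hendJ t₀ ht₀J rfl
    exact hmiss t (hJs htJ) htS
  · obtain ⟨e, he⟩ : ∃ e, HasPastEndpoint c J e := by
      by_contra h; push Not at h; exact hendJ ⟨⟨t₀, ht₀J⟩, h⟩
    have heW : e ∉ W := fun heW ↦ hend e heW he
    -- `J` has no least element (its image would be a past endpoint inside `W`)
    obtain ⟨t₁, ht₁J, ht₁₀⟩ : ∃ t₁ ∈ J, t₁ < t₀ := by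
      by_contra h; push Not at h
      haveI : Nonempty J := ⟨⟨t₀, ht₀J⟩⟩
      have h' : HasPastEndpoint c J (c t₀) := hasPastEndpoint_of_isLeast ⟨ht₀J, h⟩
      exact heW ((tendsto_nhds_unique he h') ▸ hcW t₀ ht₀)
    -- `e ≪ c t₀`: a timelike segment from `e` to `c t₀`, extended to an endless timelike curve
    obtain ⟨e', he', μ, a, b, hab, hμ, hμa, hμb⟩ := hE hJ hcJ he ht₁J ht₀J ht₁₀
    rw [mem_singleton_iff] at he'
    subst e'
    obtain ⟨Δ, D, hΔ, haD, hbD, hΔa, hΔb⟩ :=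
      LorentzianMetric.exists_isEndlessTimelikeCurve_extends hn hab hμ
    rw [hμa] at hΔa; rw [hμb] at hΔb
    have hΔc : g.IsFutureTimelikeCurveOn τ Δ D := hΔ.2.1
    -- the future Cauchy property along `Δ` up to `b`
    have hpast : IsPastEndless Δ (D ∩ Iic b) := hΔ.2.2.2.inter_Iic hbD
    obtain ⟨t, ⟨htD, htb⟩, -, htS⟩ := hFC hp Δ (D ∩ Iic b) (hΔ.1.inter ordConnected_Iic)
      (hΔc.mono inter_subset_left).isFutureCausalCurveOn hpast b ⟨hbD, self_mem_Iic⟩ hΔb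
    rcases eq_or_lt_of_le (show t ≤ b from htb) with h | h
    · subst h; rw [hΔb] at htS; exact hmiss t₀ ht₀ htS -- the crossing is `c t₀` itself
    rcases lt_trichotomy t a with h' | h' | h'
    · -- crossing below `e`: then `e ∈ I⁺(S) ⊆ W`
      refine heW ?_
      rw [hW]
      exact Or.inl (Or.inl ⟨Δ t, htS, Δ, t, a, h', hΔc.mono (hΔ.1.out htD haD), rfl, hΔa⟩)
    · -- crossing at `e`: then `e ∈ S ⊆ W`
      subst h'
      refine heW ?_
      rw [hW, ← hΔa]
      exact Or.inl (Or.inr htS)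
    · -- crossing strictly between `e` and `c t₀`: then `e ∈ I⁻(S)`, an open set, which therefore
      -- contains points of `c`, all of which lie in `I⁺(S)`
      have heP : e ∈ g.chronologicalPast τ S := by
        have h1 : Δ t ∈ g.chronologicalFuture τ {e} :=
          ⟨e, rfl, Δ, a, t, h', hΔc.mono (hΔ.1.out haD htD), hΔa, rfl⟩
        exact LorentzianMetric.chronologicalPast_mono (singleton_subset_iff.mpr htS)
          (LorentzianMetric.mem_chronologicalPast_of_mem_chronologicalFuture h1)
      obtain ⟨t', ht'J, ht'P⟩ := he.exists_mem_of_mem_nhds ⟨t₀, ht₀J⟩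
        ((LorentzianMetric.isOpen_chronologicalPast_of_boundaryless g τ S).mem_nhds heP)
      exact Set.disjoint_left.mp hdisj (hall t' (hJs ht'J)) ht'P

include hT hW hE' in
/-- **Key lemma, past side.** A future timelike curve `c` on an interval `s`, with values in `W`,
missing `S`, through a point of `I⁺(T) ∩ I⁻(S)` at `t₀`, whose future half has no future endpoint
in `W`, is impossible: `c t₀` has (P), so either the future half has no future endpoint at all —
then it meets `S` — or its future endpoint `e ∉ W` is above `c t₀` (`hE'`), hence in `I⁺(T)`, and
the endless extension of a segment from `c t₀` to `e` meets `S` beyond `c t₀` by (P), putting `e`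
in `I⁺(S)`, `S` or `I⁻(S)` — all inside `W`. [cite: ONeillSemiRiemannian1983, Ch. 14, Thm. 14.38 (pp. 421–423)] -/
theorem false_of_curve_in_domain_past (hn : 2 ≤ n) {c : ℝ → M} {s : Set ℝ}
    (hs : s.OrdConnected) (hc : g.IsFutureTimelikeCurveOn τ c s) (hcW : ∀ t ∈ s, c t ∈ W)
    (hmiss : ∀ t ∈ s, c t ∉ S) {t₀ : ℝ} (ht₀ : t₀ ∈ s)
    (hend : ∀ e ∈ W, ¬ HasFutureEndpoint c (s ∩ Ici t₀) e)
    (hQ : c t₀ ∈ g.chronologicalFuture τ T ∩ g.chronologicalPast τ S) : False := by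
  set J : Set ℝ := s ∩ Ici t₀ with hJ_def
  have hJ : J.OrdConnected := hs.inter ordConnected_Ici
  have ht₀J : t₀ ∈ J := ⟨ht₀, self_mem_Ici⟩
  have hJs : J ⊆ s := inter_subset_left
  have hcJ : g.IsFutureTimelikeCurveOn τ c J := hc.mono hJs
  -- `c t₀` is above a point `x ∈ T`, hence has property (P)
  obtain ⟨⟨x, hxT, σ, a₀, b₀, hab₀, hσ, hσa, hσb⟩, hzS⟩ := hQ
  have hzx : c t₀ ∈ g.chronologicalFuture τ {x} := ⟨x, rfl, σ, a₀, b₀, hab₀, hσ, hσa, hσb⟩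
  have hxT' := hxT
  rw [hT] at hxT'
  have hP := hxT' (c t₀) hzx hzS
  by_cases hendJ : IsFutureEndless c J
  · obtain ⟨t, htJ, -, htS⟩ := hP c J hJ hcJ hendJ t₀ ht₀J rfl
    exact hmiss t (hJs htJ) htS
  · obtain ⟨e, he⟩ : ∃ e, HasFutureEndpoint c J e := by
      by_contra h; push Not at h; exact hendJ ⟨⟨t₀, ht₀J⟩, h⟩
    have heW : e ∉ W := fun heW ↦ hend e heW he
    obtain ⟨t₁, ht₁J, ht₀₁⟩ : ∃ t₁ ∈ J, t₀ < t₁ := by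
      by_contra h; push Not at h
      haveI : Nonempty J := ⟨⟨t₀, ht₀J⟩⟩
      have h' : HasFutureEndpoint c J (c t₀) := hasFutureEndpoint_of_isGreatest ⟨ht₀J, h⟩
      exact heW ((tendsto_nhds_unique he h') ▸ hcW t₀ ht₀)
    -- `c t₀ ≪ e`
    have hze : e ∈ g.chronologicalFuture τ {c t₀} :=
      LorentzianMetric.mem_chronologicalFuture_of_mem_chronologicalPast (hE' hJ hcJ he ht₀J ht₁J ht₀₁)
    have heT : e ∈ g.chronologicalFuture τ T :=
      LorentzianMetric.mem_chronologicalFuture_trans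
        (LorentzianMetric.chronologicalFuture_mono (singleton_subset_iff.mpr hxT) hzx) hze
    obtain ⟨z', hz', μ, a, b, hab, hμ, hμa, hμb⟩ := hze
    rw [mem_singleton_iff] at hz'
    subst hz'
    obtain ⟨Δ, D, hΔ, haD, hbD, hΔa, hΔb⟩ :=
      LorentzianMetric.exists_isEndlessTimelikeCurve_extends hn hab hμ
    rw [hμa] at hΔa; rw [hμb] at hΔb
    have hΔc : g.IsFutureTimelikeCurveOn τ Δ D := hΔ.2.1
    -- property (P) along `Δ` from `a`
    have hfut : IsFutureEndless Δ (D ∩ Ici a) := isFutureEndless_inter_Ici hΔ.2.2.1 haD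
    obtain ⟨t, ⟨htD, hta⟩, -, htS⟩ := hP Δ (D ∩ Ici a) (hΔ.1.inter ordConnected_Ici)
      (hΔc.mono inter_subset_left) hfut a ⟨haD, self_mem_Ici⟩ hΔa
    rcases eq_or_lt_of_le (show a ≤ t from hta) with h | h
    · subst h; rw [hΔa] at htS; exact hmiss t₀ ht₀ htS
    refine heW ?_
    rw [hW]
    rcases lt_trichotomy t b with h' | h' | h'
    · -- crossing strictly between `c t₀` and `e`: `e ∈ I⁺(S)`
      exact Or.inl (Or.inl ⟨Δ t, htS, Δ, t, b, h', hΔc.mono (hΔ.1.out htD hbD), rfl, hΔb⟩)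
    · -- crossing at `e`: `e ∈ S`
      subst h'
      rw [← hΔb]
      exact Or.inl (Or.inr htS)
    · -- crossing above `e`: `e ∈ I⁻(S)`, and `e ∈ I⁺(T)`
      refine Or.inr ⟨heT, ?_⟩
      have h1 : Δ t ∈ g.chronologicalFuture τ {e} :=
        ⟨e, rfl, Δ, b, t, h', hΔc.mono (hΔ.1.out hbD htD), hΔb, rfl⟩
      exact LorentzianMetric.chronologicalPast_mono (singleton_subset_iff.mpr htS)
        (LorentzianMetric.mem_chronologicalPast_of_mem_chronologicalFuture h1)

include hT hW hE hE' hFC in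
/-- **`S` is a Cauchy hypersurface of every open `W' ⊆ W` which is relatively closed in `W`.**
An endless timelike curve of `W'` is a timelike curve of `M` without endpoints in `W` (an endpoint
in `W` lies in `closure W' ∩ W ⊆ W'`); if it missed `S`, it would lie in `I⁺(S)` or in
`I⁺(T) ∩ I⁻(S)` (connectedness), against `false_of_curve_in_domain_future` resp. `_past`; and it
meets the achronal set `S` at most once. O'Neill 1983, Ch. 14, Thm. 14.38, here for a future
Cauchy hypersurface with lenses. [cite: ONeillSemiRiemannian1983, Ch. 14, Thm. 14.38 and Thm. 14.55A (pp. 421–432)] -/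
theorem isCauchyHypersurface_domain (hn : 2 ≤ n) (hA : g.IsAchronal τ S) (W' : Opens M)
    (hW'W : (W' : Set M) ⊆ W) (hcl : closure (W' : Set M) ∩ W ⊆ W') :
    (g.restrict hres W').IsCauchyHypersurface (τ.restrict hres hτ W') (Subtype.val ⁻¹' S) := by
  have hdisjS : Disjoint (g.chronologicalFuture τ S) S := (LorentzianMetric.isAchronal_iff_disjoint S).mp hA
  have hdisj : Disjoint (g.chronologicalFuture τ S) (g.chronologicalPast τ S) :=
    hA.disjoint_chronologicalFuture_chronologicalPast
  intro γ s hγ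
  obtain ⟨hs, hγt, hγf, hγp⟩ := hγ
  have hcM : g.IsFutureTimelikeCurveOn τ (Subtype.val ∘ γ) s :=
    (LorentzianMetric.isFutureTimelikeCurveOn_restrict_iff g τ hres hτ W').1 hγt
  set c : ℝ → M := Subtype.val ∘ γ with hc_def
  have hcW' : ∀ t ∈ s, c t ∈ (W' : Set M) := fun t _ ↦ (γ t).2
  have hcW : ∀ t ∈ s, c t ∈ W := fun t ht ↦ hW'W (hcW' t ht)
  -- endpoints in `W` would be endpoints in `W'`
  have hendP : ∀ t₀ ∈ s, ∀ e ∈ W, ¬ HasPastEndpoint c (s ∩ Iic t₀) e := by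
    intro t₀ ht₀ e heW he
    have hecl : e ∈ closure (W' : Set M) :=
      he.mem_closure ⟨t₀, ht₀, self_mem_Iic⟩ fun t ht ↦ hcW' t ht.1
    have heW' : e ∈ (W' : Set M) := hcl ⟨hecl, heW⟩
    have he' : HasPastEndpoint c s e :=
      (hasPastEndpoint_congr_set (s := s ∩ Iic t₀) (s' := s) ⟨ht₀, self_mem_Iic⟩ ht₀
        (fun t ht ↦ ⟨fun h ↦ h.1, fun h ↦ ⟨h, ht⟩⟩) e).mp he
    exact hγp.2 ⟨e, heW'⟩ (hasPastEndpoint_subtypeVal_comp_iff.1 he')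
  have hendF : ∀ t₀ ∈ s, ∀ e ∈ W, ¬ HasFutureEndpoint c (s ∩ Ici t₀) e := by
    intro t₀ ht₀ e heW he
    have hecl : e ∈ closure (W' : Set M) := by
      haveI : Nonempty (s ∩ Ici t₀ : Set ℝ) := ⟨⟨t₀, ht₀, self_mem_Ici⟩⟩
      exact mem_closure_of_tendsto he (Eventually.of_forall fun t ↦ hcW' t t.2.1)
    have heW' : e ∈ (W' : Set M) := hcl ⟨hecl, heW⟩
    have he' : HasFutureEndpoint c s e :=
      (hasFutureEndpoint_congr_set (s := s ∩ Ici t₀) (s' := s) ⟨ht₀, self_mem_Ici⟩ ht₀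
        (fun t ht ↦ ⟨fun h ↦ h.1, fun h ↦ ⟨h, ht⟩⟩) e).mp he
    exact hγf.2 ⟨e, heW'⟩ (hasFutureEndpoint_subtypeVal_comp_iff.1 he')
  -- existence of a crossing
  have hexists : ∃ t ∈ s, c t ∈ S := by
    by_contra hmiss
    push Not at hmiss
    obtain ⟨t₀, ht₀⟩ := hγf.1
    -- every point of the curve is in `I⁺(S)` or in `I⁻(S)`
    have himg : c '' s ⊆ g.chronologicalFuture τ S ∪ g.chronologicalPast τ S := by
      rintro _ ⟨t, ht, rfl⟩
      have h := hcW t ht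
      rw [hW] at h
      rcases h with (h | h) | h
      · exact Or.inl h
      · exact absurd h (hmiss t ht)
      · exact Or.inr h.2
    have hconn : IsPreconnected (c '' s) :=
      hs.isPreconnected.image c fun t ht ↦ (hcM t ht).1.continuousAt.continuousWithinAt
    rcases hconn.subset_or_subset (LorentzianMetric.isOpen_chronologicalFuture_of_boundaryless g τ S)
      (LorentzianMetric.isOpen_chronologicalPast_of_boundaryless g τ S) hdisj himg with h | h
    · exact false_of_curve_in_domain_future hW hE hFC hn hA hs hcM hcW hmiss ht₀ (hendP t₀ ht₀)
        fun t ht ↦ h (mem_image_of_mem c ht)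
    · have hQ : c t₀ ∈ g.chronologicalFuture τ T ∩ g.chronologicalPast τ S := by
        have h1 := hcW t₀ ht₀
        rw [hW] at h1
        rcases h1 with (h1 | h1) | h1
        · exact absurd h1 (Set.disjoint_right.mp hdisj (h (mem_image_of_mem c ht₀)))
        · exact absurd h1 (hmiss t₀ ht₀)
        · exact h1
      exact false_of_curve_in_domain_past hT hW hE' hn hs hcM hcW hmiss ht₀ (hendF t₀ ht₀) hQ
  obtain ⟨t₁, ht₁, ht₁S⟩ := hexists
  refine ⟨t₁, ⟨ht₁, ht₁S⟩, fun t₂ ht₂ ↦ ?_⟩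
  -- uniqueness: two crossings of the achronal set `S` by a timelike curve
  by_contra hne
  rcases lt_or_gt_of_ne hne with h | h
  · exact hA (c t₂) ht₂.2 (c t₁) ht₁S ⟨c t₂, rfl, c, t₂, t₁, h, hcM.mono (hs.out ht₂.1 ht₁), rfl, rfl⟩
  · exact hA (c t₁) ht₁S (c t₂) ht₂.2 ⟨c t₁, rfl, c, t₁, t₂, h, hcM.mono (hs.out ht₁ ht₂.1), rfl, rfl⟩

end Cauchy

end Summit.FinalStateConjecture.FinalStateConjecture.Theorems.PhotonSphereChannels.TameCensorshipCrush

end
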